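import Summits.QuantumFields.QCD.Theses.QuarksNoInfraredClause
import HarnessLib

/-!
# Route `QuarksNoInfraredClause` (QCD): the assembly item (stmt-QuantumFields-9512)

`TorusHalfSpectrum → TwoPointWitness → ThreePointWitness → ThinQCD → QCD`: pure logic over the route's crux-only deciding
theorem `Summit.QuantumFields.QCD.Theses.QuarksNoInfraredClause.closes : TorusHalfSpectrum → ThinQCD → QCD` (which proves the
two witness supports internally), so the two middle hypotheses are simply discarded.  The cruxes `TorusHalfSpectrum` and
`ThinQCD` remain OPEN; no summit, leg or crux statement is proved (width seat ym-t4-w17 g0, free hands).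
-/

set_option autoImplicit false

namespace Summit.QuantumFields.QCD.Theorems

/-- **Item stmt-QuantumFields-9512 `QuarksNoInfraredClause.Assembly` holds.** [folklore] -/
theorem quarksNoInfraredClause_assembly_proof :
    Summit.QuantumFields.QCD.Theses.QuarksNoInfraredClause.Assembly :=
  fun h₁ _ _ h₂ => Summit.QuantumFields.QCD.Theses.QuarksNoInfraredClause.closes h₁ h₂

end Summit.QuantumFields.QCD.Theorems
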